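import Mathlib
import Literature.NumberTheory.GaloisRepresentations.EnormousSubgroup
import Literature.NumberTheory.GaloisRepresentations.CalegariEvenFontaineMazurTwo
import Literature.NumberTheory.GaloisRepresentations.NormalSubgroupsGL2
import Literature.GroupTheory.SpecificGroups.PGL2SubfieldCharP
import Literature.NumberTheory.GaloisRepresentations.SymmSqImageEnormous
import HarnessLib

/-!
# SymmPowerEnormous

Topic `Literature/NumberTheory/GaloisRepresentations`. Named literature fact(s) relocated by the gate from `Summits/Langlands/Langlands/Theorems/RamifiedCoefficientSeedAdjointLiftingGL3StubEnormousAd.lean`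
(accept-time relocation of `[cite]`d propositions written inline in a Summits proposal; human ruling 2026-08-15).
Sources: ACCGHLNSTT2023.

* `Literature.NumberTheory.GaloisRepresentations.ACC_symmSq_enormous_of_specialLinearGroup_le`
-/

namespace Literature.NumberTheory.GaloisRepresentations

open scoped MatrixGroups Pointwise
open Field Matrix
open Literature.NumberTheory.GaloisRepresentations Literature.GroupTheory.SpecificGroups
open Literature.NumberTheory.EllipticCurves

/-- **ACC+ Lemma 7.1.5 (`lemen`), the case `n = 3`.**  P. B. Allen, F. Calegari, A. Caraiani,
T. Gee, D. Helm, B. V. Le Hung, J. Newton, P. Scholze, R. Taylor, J. A. Thorne, *Potential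
automorphy over CM fields*, Ann. of Math. (2) 197 (2023), §7.1, Lemma 7.1.5, as printed: "If
`n ≥ 2` and `l > 2n+1` and `H` is a finite subgroup of `GL₂(𝔽̄_l)` containing `SL₂(𝔽_l)`, then
`Symm^{n-1} H ⊂ GL_n(𝔽̄_l)` is enormous."  (Printed proof: the image of `H` in `PGL₂(𝔽̄_l)` is
conjugate to `PSL₂(k)` or `PGL₂(k)` for a finite `k/𝔽_l` (Dickson), so
`𝔽̄_lˣ Symm^{n-1} GL₂(k) ⊃ H ⊃ Symm^{n-1} SL₂(k)`, "and the lemma follows from [geenew]".)  Stated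
for `n = 3` (so `l > 7`), in the tree's vocabulary: `𝔽̄_l` is an algebraic closure `k` of
`𝔽_l = ZMod l` (Mathlib `IsAlgClosure (ZMod l) k`); "containing `SL₂(𝔽_l)`" is
`(SL₂(𝔽_l) → GL₂(k)).range ≤ H` (Mathlib `Matrix.SpecialLinearGroup.mapGL`); `Symm² H` is the image
of `H` under the symmetric square `Matrix.GeneralLinearGroup.symSq : GL₂(k) → GL₃(k)` (the matrix
of `Sym²` in the basis `e₁², e₁e₂, e₂²`, file `CalegariEvenFontaineMazurTwo`); "enormous" is
`Subgroup.IsEnormous` (ACC+ Def. 6.2.28 (1)–(3), file `EnormousSubgroup`).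
[cite: ACCGHLNSTT2023, §7.1, Lemma 7.1.5 (lemen); Def. 6.2.28]
[file NumberTheory/GaloisRepresentations/SymmPowerEnormous] -/
def ACC_symmSq_enormous_of_specialLinearGroup_le : Prop :=
  ∀ (l : ℕ) [Fact l.Prime] (k : Type) [Field k] [Algebra (ZMod l) k] [IsAlgClosure (ZMod l) k]
    (H : Subgroup (GL (Fin 2) k)), 7 < l → Finite H →
      (Matrix.SpecialLinearGroup.mapGL k : SL(2, ZMod l) →* GL (Fin 2) k).range ≤ H →
        Subgroup.IsEnormous
          (H.map (Matrix.GeneralLinearGroup.symSq : GL (Fin 2) k →* GL (Fin 3) k))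
-- TODO(general form): `Symm^{n-1} H ⊂ GL_n(𝔽̄_l)` is enormous for every `n ≥ 2`, `l > 2n + 1`
-- (needs the symmetric powers `Symm^{n-1} : GL₂ → GL_n`, absent from the tree for `n ≥ 4`).

/-! ## `ad⁰ ≅ Sym² ⊗ det⁻¹`: the constant change of basis -/

/-! ## Discharge of the named fact -/

/-- **ACC+ Lemma 7.1.5 for `n = 3` holds**: the named fact
`ACC_symmSq_enormous_of_specialLinearGroup_le` is a theorem, proved in
`SymmSqImageEnormous.lean` (`SymmSqEnormous.isEnormous_map_symSq`: Dickson's classification of the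
projective image — tree `PGL2.exists_smul_eq_or_exists_conj_eq_of_five_le` — followed by the
explicit verification of the four clauses of "enormous" for `Sym² H`, `H ⊇ SL₂(𝔽_l)`, `l > 7`).
[cite: ACCGHLNSTT2023, §7.1, Lemma 7.1.5 (lemen); Def. 6.2.28] -/
theorem ACC_symmSq_enormous_of_specialLinearGroup_le_holds :
    ACC_symmSq_enormous_of_specialLinearGroup_le :=
  fun l _ _k _ _ _ H hl hH hS => SymmSqEnormous.isEnormous_map_symSq l H hl hH hS

end Literature.NumberTheory.GaloisRepresentations
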